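import Literature.Analysis.FluidPDE.Wei2016AngVelQuotWeighted
import HarnessLib

/-!
# The `L⁴` energy identity of `u^θ` in the smooth variable `Φ = u^θ/r` (weight `r⁴`):
# `∫ r⁴Φ³Φ' = 2ν∫ r²Φ⁴ − 3ν∫ r⁴Φ²|∇Φ|² − ∫ r⁴WΦ⁴`, and `∫ r²Φ⁴ ≤ ∫ r⁴Φ²|∇Φ|²`

Analysis/FluidPDE proof file (theorems only; no definitions, no named facts) on the way to
`Literature.Analysis.FluidPDE.Wei2016_logModulus_regularity`
(`LeiZhang2017AxisymmetricCriteria.lean`). The last step of the proof of Wei 2016, Thm. 1.1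
("this completes the proof", with `‖∇(u_r/r)‖_{L^∞L²} + ‖Ω‖_{L^∞L²} < ∞` in hand) is the
a-priori regularity argument printed in Lei–Zhang 2017, §3 (arXiv:1505.02628, p. 9):

> "We first derive an `L⁴` a priori estimate for `v^θ` … Using the equation of `v^θ` in (ANS)
> and standard energy estimate, one has
> `d/dt‖v^θ‖⁴_{L⁴} + ‖∇(v^θ)²‖²_{L²} + ‖r⁻¹(v^θ)²‖²_{L²} ≤ C|∫ vʳ(v^θ)⁴/r| ≤ C‖r⁻¹vʳ‖_{L^∞}‖v^θ‖⁴_{L⁴}`."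

In the smooth Hou–Li variable `G = Φ = angVelQuot u` (`v^θ = rΦ`, `(v^θ)⁴ = r⁴Φ⁴`,
`(v^θ)⁴/r² = r²Φ⁴`), whose equation is the tree's `IsClassicalNSSolutionOn.angVelQuot_eq`
(`Φ' + DΦ[v] = ν(ΔΦ + 2 radDerivQuot Φ) − 2WΦ`, `W = vʳ/r`), this is the following fixed-time
computation with the weight `σ = r⁴ = (x₀² + x₁²)²` (the weight-`r²` analogue is the tree's
`integral_horizSq_mul_cube_mul_eq_of_phi_eq`, `AxisymPhiFourEnergy`):

* `Wei2016.integral_rhoSq_mul_cube_mul_eq_of_phi_eq` — **the identity**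
  `∫ σG³G' = 2ν ∫ ρG⁴ − 3ν ∫ σG²|∇G|² − ∫ σWG⁴` (`ρ = x₀² + x₁²`): transport
  `−∫σG³DG[b] = ∫σWG⁴` (`D(σ)[b] = 4ρ·ρW`, `div b = 0`), reaction `−2∫σWG⁴`, diffusion
  `ν∫σG³ΔG = −3ν∫σG²|∇G|² − 4ν∫ρG³DG[x_h]`, drift `2ν∫σG³ radDerivQuot G = 2ν∫ρG³DG[x_h]`, and
  `∫ρG³DG[x_h] = −∫ρG⁴` (by parts);
* `Wei2016.integral_rho_mul_pow_four_le` — **the Hardy-type bound** `∫ ρG⁴ ≤ ∫ σG²|∇G|²`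
  (`0 ≤ ∫ G²|G x_h + ρ∇G|² = ∫ρG⁴ + 2∫ρG³DG[x_h] + ∫σG²|∇G|² = ∫σG²|∇G|² − ∫ρG⁴`), the smooth
  form of `3∫(v^θ)²|∇v^θ|² + ∫(v^θ)⁴/r² = 3∫σΦ²|∇Φ|² − 2∫ρΦ⁴ ≥ ∫ρΦ⁴`;
* `Wei2016.integral_rhoSq_mul_cube_mul_le` — hence
  **`∫ σG³G' + ν ∫ ρG⁴ ≤ B_W ∫ σG⁴`** when `|W| ≤ B_W`, `ν ≥ 0`
  (`d/dt ∫(v^θ)⁴ + 4ν∫(v^θ)⁴/r² ≤ 4‖vʳ/r‖_∞ ∫(v^θ)⁴`).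

The absolute integrability of the weighted pairings is organised through the bounded factor
`ρG² = (v^θ)²` and the square-integrable factors `xⱼG`, `xⱼ∂ᵢG`, `xⱼG'` (`j = 0, 1`) and
`ρG·∂ᵢ∂ᵢG = Γ∂ᵢ∂ᵢΦ` (hypotheses here; for a classical solution they follow from the pointwise
bounds of `Wei2016AngVelQuotWeighted`).

## References

* Z. Lei, Q. S. Zhang, arXiv:1505.02628, §3 p. 9 (the `L⁴` estimate of `v^θ`). [LeiZhang2017]
* D. Wei, arXiv:1508.03318, end of the proof of Thm. 1.1. [Wei2016]
-/

noncomputable section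

open MeasureTheory Set Function Filter Topology InnerProductSpace
open scoped RealInnerProductSpace Laplacian ContDiff ENNReal

namespace Literature.Analysis.FluidPDE

namespace Wei2016

/-! ### The weight `σ = (x₀² + x₁²)²` -/

/-- `D(ρ²)(y) h = 4 ρ(y) (y₀h₀ + y₁h₁)` (`ρ = y₀² + y₁²`). [folklore] -/
theorem hasFDerivAt_rhoSq (y : EuclideanSpace ℝ (Fin 3)) :
    HasFDerivAt (fun y : EuclideanSpace ℝ (Fin 3) => (y 0 ^ 2 + y 1 ^ 2) ^ 2)
      ((2 * (y 0 ^ 2 + y 1 ^ 2)) •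
        ((2 * y 0) • (EuclideanSpace.proj (0 : Fin 3) : EuclideanSpace ℝ (Fin 3) →L[ℝ] ℝ) +
          (2 * y 1) • (EuclideanSpace.proj (1 : Fin 3) : EuclideanSpace ℝ (Fin 3) →L[ℝ] ℝ))) y := by
  have hfun : (fun y : EuclideanSpace ℝ (Fin 3) => (y 0 ^ 2 + y 1 ^ 2) ^ 2) =
      fun y => (y 0 ^ 2 + y 1 ^ 2) * (y 0 ^ 2 + y 1 ^ 2) := by
    funext y; ring
  rw [hfun]
  refine ((hasFDerivAt_rho y).mul (hasFDerivAt_rho y)).congr_fderiv ?_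
  ext v
  simp only [_root_.smul_apply, _root_.add_apply, smul_eq_mul, PiLp.proj_apply]
  ring

/-- `∂ₕ(ρ²)(y) = 4 ρ(y) (y₀h₀ + y₁h₁)`. [folklore] -/
theorem fderiv_rhoSq_apply (y h : EuclideanSpace ℝ (Fin 3)) :
    fderiv ℝ (fun y : EuclideanSpace ℝ (Fin 3) => (y 0 ^ 2 + y 1 ^ 2) ^ 2) y h =
      4 * (y 0 ^ 2 + y 1 ^ 2) * (y 0 * h 0 + y 1 * h 1) := by
  rw [(hasFDerivAt_rhoSq y).fderiv]
  simp only [_root_.smul_apply, _root_.add_apply, smul_eq_mul, PiLp.proj_apply]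
  ring

/-- `ρ²` is smooth. [folklore] -/
theorem contDiff_rhoSq {n : WithTop ℕ∞} :
    ContDiff ℝ n (fun y : EuclideanSpace ℝ (Fin 3) => (y 0 ^ 2 + y 1 ^ 2) ^ 2) :=
  contDiff_horizSq.pow 2

/-! ### Integrations by parts against the weight `σ` -/

section IBP

variable {G : EuclideanSpace ℝ (Fin 3) → ℝ} {b : EuclideanSpace ℝ (Fin 3) → EuclideanSpace ℝ (Fin 3)}

/-- **Transport by parts against `σ`, per coordinate**:
`∫ σ bᵢ · 4G³∂ᵢG = −∫ (∂ᵢσ bᵢ + σ ∂ᵢbᵢ) G⁴`. [folklore] -/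
theorem integral_rhoSq_mul_coord_mul_fderiv_pow_four (hG : Differentiable ℝ G)
    (hb : Differentiable ℝ b) (i : Fin 3)
    (ifg : Integrable (fun x : EuclideanSpace ℝ (Fin 3) => (x 0 ^ 2 + x 1 ^ 2) ^ 2 * b x i * G x ^ 4) volume)
    (ifg' : Integrable (fun x : EuclideanSpace ℝ (Fin 3) => (x 0 ^ 2 + x 1 ^ 2) ^ 2 * b x i *
      (4 * G x ^ 3 * fderiv ℝ G x (EuclideanSpace.single i 1))) volume)
    (if'g : Integrable (fun x : EuclideanSpace ℝ (Fin 3) =>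
      (fderiv ℝ (fun y : EuclideanSpace ℝ (Fin 3) => (y 0 ^ 2 + y 1 ^ 2) ^ 2) x (EuclideanSpace.single i 1) * b x i +
        (x 0 ^ 2 + x 1 ^ 2) ^ 2 * fderiv ℝ b x (EuclideanSpace.single i 1) i) * G x ^ 4) volume) :
    ∫ x : EuclideanSpace ℝ (Fin 3), (x 0 ^ 2 + x 1 ^ 2) ^ 2 * b x i *
        (4 * G x ^ 3 * fderiv ℝ G x (EuclideanSpace.single i 1)) =
      -∫ x : EuclideanSpace ℝ (Fin 3),
        (fderiv ℝ (fun y : EuclideanSpace ℝ (Fin 3) => (y 0 ^ 2 + y 1 ^ 2) ^ 2) x (EuclideanSpace.single i 1) * b x i +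
          (x 0 ^ 2 + x 1 ^ 2) ^ 2 * fderiv ℝ b x (EuclideanSpace.single i 1) i) * G x ^ 4 := by
  set e : EuclideanSpace ℝ (Fin 3) := EuclideanSpace.single i 1 with he
  have hσd : Differentiable ℝ fun y : EuclideanSpace ℝ (Fin 3) => (y 0 ^ 2 + y 1 ^ 2) ^ 2 :=
    fun y => (hasFDerivAt_rhoSq y).differentiableAt
  have hbid : Differentiable ℝ fun x => b x i := fun x =>
    ((EuclideanSpace.proj (𝕜 := ℝ) i).differentiableAt).comp x (hb x)
  have hf : Differentiable ℝ fun x : EuclideanSpace ℝ (Fin 3) => (x 0 ^ 2 + x 1 ^ 2) ^ 2 * b x i :=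
    hσd.mul hbid
  have hg : Differentiable ℝ fun x => G x ^ 4 := hG.pow 4
  have hDf : ∀ x, fderiv ℝ (fun y : EuclideanSpace ℝ (Fin 3) => (y 0 ^ 2 + y 1 ^ 2) ^ 2 * b y i) x e =
      fderiv ℝ (fun y : EuclideanSpace ℝ (Fin 3) => (y 0 ^ 2 + y 1 ^ 2) ^ 2) x e * b x i +
        (x 0 ^ 2 + x 1 ^ 2) ^ 2 * fderiv ℝ b x e i := by
    intro x
    rw [fderiv_fun_mul (hσd x) (hbid x)]
    simp only [_root_.add_apply, _root_.smul_apply, smul_eq_mul, fderiv_apply_coord_vec3 (hb x) i e]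
    ring
  have hDg : ∀ x, fderiv ℝ (fun y => G y ^ 4) x e = 4 * G x ^ 3 * fderiv ℝ G x e :=
    fun x => fderiv_pow_four_apply (hG x) e
  have hibp := integral_mul_fderiv_eq_neg_fderiv_mul_of_integrable (μ := volume)
    (f := fun x : EuclideanSpace ℝ (Fin 3) => (x 0 ^ 2 + x 1 ^ 2) ^ 2 * b x i) (g := fun x => G x ^ 4)
    (v := e) (if'g.congr (Eventually.of_forall fun x => by simp only [hDf x]))
    (ifg'.congr (Eventually.of_forall fun x => by simp only [hDg x]))
    ifg (fun x _ => hf x) (fun x _ => hg x)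
  simp only [hDf, hDg] at hibp
  exact hibp

/-- **Diffusion by parts against `σ`, per coordinate**:
`∫ σ G³ ∂ᵢ∂ᵢG = −∫ (∂ᵢσ G³ + 3 σ G² ∂ᵢG) ∂ᵢG`. [folklore] -/
theorem integral_rhoSq_mul_cube_mul_fderiv_fderiv (hG : ContDiff ℝ 2 G) (i : Fin 3)
    (ifg : Integrable (fun x : EuclideanSpace ℝ (Fin 3) => (x 0 ^ 2 + x 1 ^ 2) ^ 2 * G x ^ 3 *
      fderiv ℝ G x (EuclideanSpace.single i 1)) volume)
    (ifg' : Integrable (fun x : EuclideanSpace ℝ (Fin 3) => (x 0 ^ 2 + x 1 ^ 2) ^ 2 * G x ^ 3 *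
      fderiv ℝ (fun y => fderiv ℝ G y (EuclideanSpace.single i 1)) x (EuclideanSpace.single i 1)) volume)
    (if'g : Integrable (fun x : EuclideanSpace ℝ (Fin 3) =>
      (fderiv ℝ (fun y : EuclideanSpace ℝ (Fin 3) => (y 0 ^ 2 + y 1 ^ 2) ^ 2) x (EuclideanSpace.single i 1) * G x ^ 3 +
        (x 0 ^ 2 + x 1 ^ 2) ^ 2 * (3 * G x ^ 2 * fderiv ℝ G x (EuclideanSpace.single i 1))) *
        fderiv ℝ G x (EuclideanSpace.single i 1)) volume) :
    ∫ x : EuclideanSpace ℝ (Fin 3), (x 0 ^ 2 + x 1 ^ 2) ^ 2 * G x ^ 3 *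
        fderiv ℝ (fun y => fderiv ℝ G y (EuclideanSpace.single i 1)) x (EuclideanSpace.single i 1) =
      -∫ x : EuclideanSpace ℝ (Fin 3),
        (fderiv ℝ (fun y : EuclideanSpace ℝ (Fin 3) => (y 0 ^ 2 + y 1 ^ 2) ^ 2) x (EuclideanSpace.single i 1) * G x ^ 3 +
          (x 0 ^ 2 + x 1 ^ 2) ^ 2 * (3 * G x ^ 2 * fderiv ℝ G x (EuclideanSpace.single i 1))) *
          fderiv ℝ G x (EuclideanSpace.single i 1) := by
  set e : EuclideanSpace ℝ (Fin 3) := EuclideanSpace.single i 1 with he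
  have hGd : Differentiable ℝ G := hG.differentiable (by norm_num)
  have hσd : Differentiable ℝ fun y : EuclideanSpace ℝ (Fin 3) => (y 0 ^ 2 + y 1 ^ 2) ^ 2 :=
    fun y => (hasFDerivAt_rhoSq y).differentiableAt
  have hG3 : Differentiable ℝ fun x => G x ^ 3 := hGd.pow 3
  have hf : Differentiable ℝ fun x : EuclideanSpace ℝ (Fin 3) => (x 0 ^ 2 + x 1 ^ 2) ^ 2 * G x ^ 3 :=
    hσd.mul hG3
  have hg1 : ContDiff ℝ 1 fun y => fderiv ℝ G y e :=
    contDiff_fderiv_apply_const_succ (n := 1) (by exact_mod_cast hG) e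
  have hg : Differentiable ℝ fun y => fderiv ℝ G y e := hg1.differentiable one_ne_zero
  have hDf : ∀ x, fderiv ℝ (fun y : EuclideanSpace ℝ (Fin 3) => (y 0 ^ 2 + y 1 ^ 2) ^ 2 * G y ^ 3) x e =
      fderiv ℝ (fun y : EuclideanSpace ℝ (Fin 3) => (y 0 ^ 2 + y 1 ^ 2) ^ 2) x e * G x ^ 3 +
        (x 0 ^ 2 + x 1 ^ 2) ^ 2 * (3 * G x ^ 2 * fderiv ℝ G x e) := by
    intro x
    rw [fderiv_fun_mul (hσd x) (hG3 x)]
    simp only [_root_.add_apply, _root_.smul_apply, smul_eq_mul, fderiv_pow_three_apply (hGd x) e]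
    ring
  have hibp := integral_mul_fderiv_eq_neg_fderiv_mul_of_integrable (μ := volume)
    (f := fun x : EuclideanSpace ℝ (Fin 3) => (x 0 ^ 2 + x 1 ^ 2) ^ 2 * G x ^ 3)
    (g := fun y => fderiv ℝ G y e) (v := e)
    (if'g.congr (Eventually.of_forall fun x => by simp only [hDf x])) ifg' ifg
    (fun x _ => hf x) (fun x _ => hg x)
  simp only [hDf] at hibp
  exact hibp

/-- **By parts for the drift/axis term**: `∫ ρ xⱼ · 4G³∂ⱼG = −∫ (2xⱼ² + ρ) G⁴` (`j = 0, 1`;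
`∂ⱼ(ρ xⱼ) = 2xⱼ² + ρ`). [folklore] -/
theorem integral_rho_mul_coord_mul_fderiv_pow_four (hG : Differentiable ℝ G) {j : Fin 3}
    (hj : j = 0 ∨ j = 1)
    (ifg : Integrable (fun x : EuclideanSpace ℝ (Fin 3) => (x 0 ^ 2 + x 1 ^ 2) * x j * G x ^ 4) volume)
    (ifg' : Integrable (fun x : EuclideanSpace ℝ (Fin 3) => (x 0 ^ 2 + x 1 ^ 2) * x j *
      (4 * G x ^ 3 * fderiv ℝ G x (EuclideanSpace.single j 1))) volume)
    (if'g : Integrable (fun x : EuclideanSpace ℝ (Fin 3) => (2 * x j ^ 2 + (x 0 ^ 2 + x 1 ^ 2)) * G x ^ 4) volume) :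
    ∫ x : EuclideanSpace ℝ (Fin 3), (x 0 ^ 2 + x 1 ^ 2) * x j *
        (4 * G x ^ 3 * fderiv ℝ G x (EuclideanSpace.single j 1)) =
      -∫ x : EuclideanSpace ℝ (Fin 3), (2 * x j ^ 2 + (x 0 ^ 2 + x 1 ^ 2)) * G x ^ 4 := by
  set e : EuclideanSpace ℝ (Fin 3) := EuclideanSpace.single j 1 with he
  have hρd : ∀ y : EuclideanSpace ℝ (Fin 3), HasFDerivAt (fun y : EuclideanSpace ℝ (Fin 3) => y 0 ^ 2 + y 1 ^ 2)
      ((2 * y 0) • (EuclideanSpace.proj (0 : Fin 3) : EuclideanSpace ℝ (Fin 3) →L[ℝ] ℝ) +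
        (2 * y 1) • (EuclideanSpace.proj (1 : Fin 3) : EuclideanSpace ℝ (Fin 3) →L[ℝ] ℝ)) y :=
    hasFDerivAt_rho
  have hxj : ∀ y : EuclideanSpace ℝ (Fin 3), HasFDerivAt (fun y : EuclideanSpace ℝ (Fin 3) => y j)
      (EuclideanSpace.proj (𝕜 := ℝ) j : EuclideanSpace ℝ (Fin 3) →L[ℝ] ℝ) y := fun y =>
    (EuclideanSpace.proj (𝕜 := ℝ) j).hasFDerivAt
  have hf : ∀ y, HasFDerivAt (fun y : EuclideanSpace ℝ (Fin 3) => (y 0 ^ 2 + y 1 ^ 2) * y j)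
      ((y 0 ^ 2 + y 1 ^ 2) • (EuclideanSpace.proj (𝕜 := ℝ) j : EuclideanSpace ℝ (Fin 3) →L[ℝ] ℝ) +
        y j • ((2 * y 0) • (EuclideanSpace.proj (0 : Fin 3) : EuclideanSpace ℝ (Fin 3) →L[ℝ] ℝ) +
          (2 * y 1) • (EuclideanSpace.proj (1 : Fin 3) : EuclideanSpace ℝ (Fin 3) →L[ℝ] ℝ))) y :=
    fun y => (hρd y).mul (hxj y)
  have hej : e j = 1 := by simp [he]
  have he0 : j = 0 → e 0 = 1 := fun h => by subst h; simp [he]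
  have he1 : j = 1 → e 1 = 1 := fun h => by subst h; simp [he]
  have hDf : ∀ y, fderiv ℝ (fun y : EuclideanSpace ℝ (Fin 3) => (y 0 ^ 2 + y 1 ^ 2) * y j) y e =
      2 * y j ^ 2 + (y 0 ^ 2 + y 1 ^ 2) := by
    intro y
    rw [(hf y).fderiv]
    simp only [_root_.add_apply, _root_.smul_apply, smul_eq_mul, PiLp.proj_apply, hej]
    rcases hj with rfl | rfl
    · simp [he]; ring
    · simp [he]; ring
  have hDg : ∀ x, fderiv ℝ (fun y => G y ^ 4) x e = 4 * G x ^ 3 * fderiv ℝ G x e :=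
    fun x => fderiv_pow_four_apply (hG x) e
  have hibp := integral_mul_fderiv_eq_neg_fderiv_mul_of_integrable (μ := volume)
    (f := fun y : EuclideanSpace ℝ (Fin 3) => (y 0 ^ 2 + y 1 ^ 2) * y j) (g := fun x => G x ^ 4)
    (v := e) (if'g.congr (Eventually.of_forall fun x => by simp only [hDf x]))
    (ifg'.congr (Eventually.of_forall fun x => by simp only [hDg x]))
    ifg (fun x _ => (hf x).differentiableAt) (fun x _ => (hG x).pow 4)
  simp only [hDf, hDg] at hibp
  exact hibp

end IBP

/-! ### The identity `∫ σG³G' = 2ν∫ρG⁴ − 3ν∫σG²|∇G|² − ∫σWG⁴` -/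

section Identity

variable {G G' W : EuclideanSpace ℝ (Fin 3) → ℝ} {b : EuclideanSpace ℝ (Fin 3) → EuclideanSpace ℝ (Fin 3)}
  {ν : ℝ}

set_option maxHeartbeats 1600000 in
/-- **The `L⁴`-energy identity of `v^θ` in the variable `Φ = v^θ/r`** (the computation behind
Lei–Zhang 2017, §3 p. 9, "`d/dt‖v^θ‖⁴_{L⁴} + … ≤ C|∫vʳ(v^θ)⁴/r|`"). Let `G ∈ C²` be an
axisymmetric scalar with `G' + DG[b] = ν(ΔG + 2 radDerivQuot G) − 2WG` pointwise, `b ∈ C¹`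
divergence free, bounded with bounded derivative, `x₀b₀ + x₁b₁ = ρW` (`ρ = x₀² + x₁²`), `W`
continuous and bounded, `G, ∂ᵢG ∈ L²`, `xⱼG, xⱼ∂ᵢG, xⱼG' ∈ L²` (`j = 0, 1`),
`ρG ∂ᵢ∂ᵢG ∈ L¹`, `G` and `ρG²` bounded. Then, with `σ = ρ²`,
`∫ σG³G' = 2ν ∫ ρG⁴ − 3ν ∫ σG²|∇G|² − ∫ σWG⁴`. [cite: LeiZhang2017, §3 p. 9] -/
theorem integral_rhoSq_mul_cube_mul_eq_of_phi_eq (hG : ContDiff ℝ 2 G) (hax : IsAxisymmetricScalar G)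
    (hb : ContDiff ℝ 1 b) (hdiv : VectorCalculus.IsDivFree b) (hWc : Continuous W)
    (h0 : MemLp G 2 volume)
    (h1 : ∀ i : Fin 3, MemLp (fun x => fderiv ℝ G x (EuclideanSpace.single i 1)) 2 volume)
    (hxG : ∀ j : Fin 3, j = 0 ∨ j = 1 → MemLp (fun x : EuclideanSpace ℝ (Fin 3) => x j * G x) 2 volume)
    (hxD : ∀ j : Fin 3, j = 0 ∨ j = 1 → ∀ i : Fin 3,
      MemLp (fun x : EuclideanSpace ℝ (Fin 3) => x j * fderiv ℝ G x (EuclideanSpace.single i 1)) 2 volume)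
    (hxG' : ∀ j : Fin 3, j = 0 ∨ j = 1 → MemLp (fun x : EuclideanSpace ℝ (Fin 3) => x j * G' x) 2 volume)
    (hΓDD : ∀ i : Fin 3, Integrable (fun x : EuclideanSpace ℝ (Fin 3) => (x 0 ^ 2 + x 1 ^ 2) * G x *
      fderiv ℝ (fun y => fderiv ℝ G y (EuclideanSpace.single i 1)) x (EuclideanSpace.single i 1)) volume)
    {BG : ℝ} (hGB : ∀ x, |G x| ≤ BG) {B₂ : ℝ} (hB₂ : ∀ x, (x 0 ^ 2 + x 1 ^ 2) * G x ^ 2 ≤ B₂)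
    {B : ℝ} (hbB : ∀ x, ‖b x‖ ≤ B) {B' : ℝ} (hDb : ∀ x, ‖fderiv ℝ b x‖ ≤ B')
    {BW : ℝ} (hWB : ∀ x, |W x| ≤ BW)
    (hW : ∀ x, x 0 * b x 0 + x 1 * b x 1 = (x 0 ^ 2 + x 1 ^ 2) * W x)
    (heq : ∀ x, G' x + fderiv ℝ G x (b x) = ν * ((Δ G) x + 2 * radDerivQuot G x) - 2 * W x * G x) :
    ∫ x, (x 0 ^ 2 + x 1 ^ 2) ^ 2 * G x ^ 3 * G' x =
      2 * ν * (∫ x, (x 0 ^ 2 + x 1 ^ 2) * G x ^ 4)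
      - 3 * ν * (∫ x, (x 0 ^ 2 + x 1 ^ 2) ^ 2 * G x ^ 2 *
          (fderiv ℝ G x (EuclideanSpace.single 0 1) ^ 2 + fderiv ℝ G x (EuclideanSpace.single 1 1) ^ 2 +
            fderiv ℝ G x (EuclideanSpace.single 2 1) ^ 2))
      - ∫ x, (x 0 ^ 2 + x 1 ^ 2) ^ 2 * W x * G x ^ 4 := by
  -- abbreviations
  set e : Fin 3 → EuclideanSpace ℝ (Fin 3) := fun i => EuclideanSpace.single i 1 with he
  have he' : ∀ i, EuclideanSpace.single i (1 : ℝ) = e i := fun i => rfl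
  simp only [he'] at h1 hxD hΓDD ⊢
  set ρ : EuclideanSpace ℝ (Fin 3) → ℝ := fun y => y 0 ^ 2 + y 1 ^ 2 with hρ
  have hρ' : ∀ x : EuclideanSpace ℝ (Fin 3), x 0 ^ 2 + x 1 ^ 2 = ρ x := fun x => rfl
  simp only [hρ'] at hB₂ hW hΓDD ⊢
  -- regularity
  have hGd : Differentiable ℝ G := hG.differentiable (by norm_num)
  have hbd : Differentiable ℝ b := hb.differentiable one_ne_zero
  have cG : Continuous G := hG.continuous
  have cρ : Continuous ρ := (contDiff_horizSq (n := 0)).continuous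
  have cb : ∀ i, Continuous fun x => b x i := fun i => (contDiff_apply_coord_vec3 hb i).continuous
  have cDb : ∀ v i, Continuous fun x => fderiv ℝ b x v i := fun v i =>
    (contDiff_apply_coord_vec3 (contDiff_zero.2 ((hb.continuous_fderiv one_ne_zero).clm_apply
      continuous_const)) i).continuous
  have cx : ∀ i : Fin 3, Continuous fun x : EuclideanSpace ℝ (Fin 3) => x i := fun i =>
    (contDiff_piLp_apply (𝕜 := ℝ) (p := 2) (n := 0) (i := i)).continuous
  have cxG : ∀ i : Fin 3, Continuous fun x : EuclideanSpace ℝ (Fin 3) => x i * G x := fun i => (cx i).mul cG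
  have cP : Continuous fun x => ρ x * G x ^ 2 := cρ.mul (cG.pow 2)
  -- pointwise formulas
  have hσ0 : ∀ x, fderiv ℝ (fun y => ρ y ^ 2) x (e 0) = 4 * ρ x * x 0 := fun x => by
    rw [hρ, fderiv_rhoSq_apply]; simp [he]
  have hσ1 : ∀ x, fderiv ℝ (fun y => ρ y ^ 2) x (e 1) = 4 * ρ x * x 1 := fun x => by
    rw [hρ, fderiv_rhoSq_apply]; simp [he]
  have hσ2 : ∀ x, fderiv ℝ (fun y => ρ y ^ 2) x (e 2) = 0 := fun x => by
    rw [hρ, fderiv_rhoSq_apply]; simp [he]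
  have hdivx : ∀ x, fderiv ℝ b x (e 0) 0 + fderiv ℝ b x (e 1) 1 + fderiv ℝ b x (e 2) 2 = 0 := by
    intro x
    have h := hdiv x
    rw [divergence_eq_sum_three] at h
    exact h
  have hDGb : ∀ x, fderiv ℝ G x (b x) = b x 0 * fderiv ℝ G x (e 0) + b x 1 * fderiv ℝ G x (e 1) +
      b x 2 * fderiv ℝ G x (e 2) := fun x => fderiv_apply_eq_sum_three G x (b x)
  have hρq : ∀ x, ρ x * radDerivQuot G x = x 0 * fderiv ℝ G x (e 0) + x 1 * fderiv ℝ G x (e 1) := by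
    intro x
    have h := fderiv_apply_horizontal_eq hG hax x
    rw [map_add, map_smul, map_smul, smul_eq_mul, smul_eq_mul, cylRadius_sq] at h
    rw [← h]
  have hlap : ∀ x, (Δ G) x = fderiv ℝ (fun y => fderiv ℝ G y (e 0)) x (e 0) +
      fderiv ℝ (fun y => fderiv ℝ G y (e 1)) x (e 1) + fderiv ℝ (fun y => fderiv ℝ G y (e 2)) x (e 2) := by
    intro x
    rw [laplacian_eq_sum_fderiv_fderiv (EuclideanSpace.basisFun (Fin 3) ℝ) hG x]
    simp only [EuclideanSpace.basisFun_apply, Fin.sum_univ_three, he]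
  have hPx : ∀ x, ρ x * G x ^ 2 = (x 0 * G x) ^ 2 + (x 1 * G x) ^ 2 := fun x => by simp only [hρ]; ring
  -- bounds on the bounded factors
  have bP : ∀ x, ‖ρ x * G x ^ 2‖ ≤ B₂ := fun x => by
    rw [Real.norm_of_nonneg (by positivity)]; exact hB₂ x
  have bG : ∀ x, ‖G x‖ ≤ BG := fun x => by rw [Real.norm_eq_abs]; exact hGB x
  have bb : ∀ i x, ‖b x i‖ ≤ B := fun i x => (PiLp.norm_apply_le (b x) i).trans (hbB x)
  have bDb : ∀ i x, ‖fderiv ℝ b x (e i) i‖ ≤ B' := fun i x => by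
    calc ‖fderiv ℝ b x (e i) i‖ ≤ ‖fderiv ℝ b x (e i)‖ := PiLp.norm_apply_le _ i
      _ ≤ ‖fderiv ℝ b x‖ * ‖e i‖ := (fderiv ℝ b x).le_opNorm (e i)
      _ = ‖fderiv ℝ b x‖ := by simp [he]
      _ ≤ B' := hDb x
  have bW : ∀ x, ‖W x‖ ≤ BW := fun x => by rw [Real.norm_eq_abs]; exact hWB x
  have bxG : ∀ i : Fin 3, i = 0 ∨ i = 1 → ∀ x, ‖x i * G x‖ ≤ Real.sqrt B₂ := by
    intro i hi x
    rw [Real.norm_eq_abs]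
    refine Real.abs_le_sqrt ?_
    have hx : x i ^ 2 ≤ ρ x := by
      rcases hi with rfl | rfl
      · show x 0 ^ 2 ≤ x 0 ^ 2 + x 1 ^ 2; nlinarith [sq_nonneg (x 1)]
      · show x 1 ^ 2 ≤ x 0 ^ 2 + x 1 ^ 2; nlinarith [sq_nonneg (x 0)]
    calc (x i * G x) ^ 2 = x i ^ 2 * G x ^ 2 := by ring
      _ ≤ ρ x * G x ^ 2 := mul_le_mul_of_nonneg_right hx (sq_nonneg _)
      _ ≤ B₂ := hB₂ x
  have bxG2 : ∀ i : Fin 3, i = 0 ∨ i = 1 → ∀ x, ‖(x i * G x) ^ 2‖ ≤ B₂ := by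
    intro i hi x
    rw [Real.norm_of_nonneg (sq_nonneg _)]
    have h := bxG i hi x
    rw [Real.norm_eq_abs] at h
    have hB₂0 : 0 ≤ B₂ := le_trans (by positivity) (hB₂ 0)
    calc (x i * G x) ^ 2 = |x i * G x| ^ 2 := (sq_abs _).symm
      _ ≤ Real.sqrt B₂ ^ 2 := pow_le_pow_left₀ (abs_nonneg _) h 2
      _ = B₂ := Real.sq_sqrt hB₂0
  -- a multiplier lemma
  have key : ∀ {f g : EuclideanSpace ℝ (Fin 3) → ℝ} {C : ℝ}, Continuous f → (∀ x, ‖f x‖ ≤ C) →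
      Integrable g volume → Integrable (fun x => f x * g x) volume :=
    fun hf hC hg => hg.bdd_mul hf.aestronglyMeasurable (ae_of_all _ hC)
  -- base integrable products
  have iGG : Integrable (fun x => G x * G x) volume := h0.integrable_mul h0
  have iP : Integrable (fun x => ρ x * G x ^ 2) volume :=
    (((hxG 0 (Or.inl rfl)).integrable_sq).add ((hxG 1 (Or.inr rfl)).integrable_sq)).congr
      (ae_of_all _ fun x => by simp only [Pi.add_apply, hPx])
  have iXGG' : Integrable (fun x => x 0 * G x * (x 0 * G' x) + x 1 * G x * (x 1 * G' x)) volume :=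
    ((hxG 0 (Or.inl rfl)).integrable_mul (hxG' 0 (Or.inl rfl))).add
      ((hxG 1 (Or.inr rfl)).integrable_mul (hxG' 1 (Or.inr rfl)))
  have iXGD : ∀ i, Integrable (fun x => x 0 * G x * (x 0 * fderiv ℝ G x (e i)) +
      x 1 * G x * (x 1 * fderiv ℝ G x (e i))) volume := fun i =>
    ((hxG 0 (Or.inl rfl)).integrable_mul (hxD 0 (Or.inl rfl) i)).add
      ((hxG 1 (Or.inr rfl)).integrable_mul (hxD 1 (Or.inr rfl) i))
  have iXDD : ∀ i, Integrable (fun x => (x 0 * fderiv ℝ G x (e i)) ^ 2 + (x 1 * fderiv ℝ G x (e i)) ^ 2) volume :=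
    fun i => ((hxD 0 (Or.inl rfl) i).integrable_sq).add ((hxD 1 (Or.inr rfl) i).integrable_sq)
  have ixGD : ∀ j : Fin 3, j = 0 ∨ j = 1 → ∀ i, Integrable (fun x => x j * G x * fderiv ℝ G x (e i)) volume :=
    fun j hj i => (hxG j hj).integrable_mul (h1 i)
  have ixGG : ∀ j : Fin 3, j = 0 ∨ j = 1 → Integrable (fun x => x j * G x * G x) volume :=
    fun j hj => (hxG j hj).integrable_mul h0
  -- the integrands
  have iI : Integrable (fun x => ρ x ^ 2 * G x ^ 3 * G' x) volume :=
    (key cP bP iXGG').congr (ae_of_all _ fun x => by simp only [hρ]; ring)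
  have iT : ∀ i, Integrable (fun x => ρ x ^ 2 * b x i * (G x ^ 3 * fderiv ℝ G x (e i))) volume := by
    intro i
    exact (key (cb i) (bb i) (key cP bP (iXGD i))).congr (ae_of_all _ fun x => by simp only [hρ]; ring)
  have iW : Integrable (fun x => ρ x ^ 2 * W x * G x ^ 4) volume :=
    (key hWc bW (key cP bP iP)).congr (ae_of_all _ fun x => by simp only; ring)
  have iL : ∀ i, Integrable (fun x => ρ x ^ 2 * G x ^ 3 *
      fderiv ℝ (fun y => fderiv ℝ G y (e i)) x (e i)) volume := fun i =>
    (key cP bP (hΓDD i)).congr (ae_of_all _ fun x => by simp only; ring)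
  have iX : ∀ i : Fin 3, i = 0 ∨ i = 1 →
      Integrable (fun x => ρ x * x i * G x ^ 3 * fderiv ℝ G x (e i)) volume := by
    intro i hi
    exact (key cP bP (ixGD i hi i)).congr (ae_of_all _ fun x => by simp only; ring)
  have iD : ∀ i, Integrable (fun x => ρ x ^ 2 * G x ^ 2 * fderiv ℝ G x (e i) ^ 2) volume := fun i =>
    (key cP bP (iXDD i)).congr (ae_of_all _ fun x => by simp only [hρ]; ring)
  have iF1 : ∀ i, Integrable (fun x => ρ x ^ 2 * b x i * G x ^ 4) volume := fun i =>
    (key (cb i) (bb i) (key cP bP iP)).congr (ae_of_all _ fun x => by simp only; ring)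
  have iσDb : ∀ i, Integrable (fun x => ρ x ^ 2 * fderiv ℝ b x (e i) i * G x ^ 4) volume := fun i =>
    (key (cDb (e i) i) (bDb i) (key cP bP iP)).congr (ae_of_all _ fun x => by simp only; ring)
  have iρxbG4 : ∀ i : Fin 3, i = 0 ∨ i = 1 → Integrable (fun x => ρ x * x i * b x i * G x ^ 4) volume := by
    intro i hi
    exact (key (cb i) (bb i) (key cP bP (ixGG i hi))).congr (ae_of_all _ fun x => by simp only; ring)
  have iF2 : ∀ i, Integrable (fun x => (fderiv ℝ (fun y => ρ y ^ 2) x (e i) * b x i +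
      ρ x ^ 2 * fderiv ℝ b x (e i) i) * G x ^ 4) volume := by
    intro i
    match i with
    | 0 =>
      refine (((iρxbG4 0 (Or.inl rfl)).const_mul 4).add (iσDb 0)).congr (ae_of_all _ fun x => ?_)
      simp only [hσ0, Pi.add_apply]; ring
    | 1 =>
      refine (((iρxbG4 1 (Or.inr rfl)).const_mul 4).add (iσDb 1)).congr (ae_of_all _ fun x => ?_)
      simp only [hσ1, Pi.add_apply]; ring
    | 2 =>
      refine (iσDb 2).congr (ae_of_all _ fun x => ?_)
      simp only [hσ2]; ring
  have iF3 : ∀ i, Integrable (fun x => ρ x ^ 2 * G x ^ 3 * fderiv ℝ G x (e i)) volume := fun i =>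
    (key cP bP (iXGD i)).congr (ae_of_all _ fun x => by simp only [hρ]; ring)
  have iF4 : ∀ i, Integrable (fun x => (fderiv ℝ (fun y => ρ y ^ 2) x (e i) * G x ^ 3 +
      ρ x ^ 2 * (3 * G x ^ 2 * fderiv ℝ G x (e i))) * fderiv ℝ G x (e i)) volume := by
    intro i
    match i with
    | 0 =>
      refine (((iX 0 (Or.inl rfl)).const_mul 4).add ((iD 0).const_mul 3)).congr
        (ae_of_all _ fun x => ?_)
      simp only [hσ0, Pi.add_apply]; ring
    | 1 =>
      refine (((iX 1 (Or.inr rfl)).const_mul 4).add ((iD 1).const_mul 3)).congr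
        (ae_of_all _ fun x => ?_)
      simp only [hσ1, Pi.add_apply]; ring
    | 2 =>
      refine ((iD 2).const_mul 3).congr (ae_of_all _ fun x => ?_)
      simp only [hσ2]; ring
  have iXf : Integrable (fun x => ρ x * G x ^ 3 * (x 0 * fderiv ℝ G x (e 0) + x 1 * fderiv ℝ G x (e 1))) volume :=
    ((iX 0 (Or.inl rfl)).add (iX 1 (Or.inr rfl))).congr (ae_of_all _ fun x => by
      simp only [Pi.add_apply]; ring)
  have iDf : Integrable (fun x => ρ x ^ 2 * G x ^ 2 * (fderiv ℝ G x (e 0) ^ 2 + fderiv ℝ G x (e 1) ^ 2 +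
      fderiv ℝ G x (e 2) ^ 2)) volume :=
    (((iD 0).add (iD 1)).add (iD 2)).congr (ae_of_all _ fun x => by
      simp only [Pi.add_apply]; ring)
  have iP4 : Integrable (fun x => ρ x * G x ^ 4) volume :=
    (key cP bP iGG).congr (ae_of_all _ fun x => by simp only; ring)
  have ixxG4 : ∀ i : Fin 3, i = 0 ∨ i = 1 → Integrable (fun x => x i ^ 2 * G x ^ 4) volume := by
    intro i hi
    have cx2 : Continuous fun x : EuclideanSpace ℝ (Fin 3) => (x i * G x) ^ 2 := (cxG i).pow 2
    exact (key cx2 (bxG2 i hi) iGG).congr (ae_of_all _ fun x => by simp only; ring)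
  -- the integrations by parts, per coordinate
  have ibp1 : ∀ i, 4 * ∫ x, ρ x ^ 2 * b x i * (G x ^ 3 * fderiv ℝ G x (e i)) =
      -∫ x, (fderiv ℝ (fun y => ρ y ^ 2) x (e i) * b x i + ρ x ^ 2 * fderiv ℝ b x (e i) i) * G x ^ 4 := by
    intro i
    have h := integral_rhoSq_mul_coord_mul_fderiv_pow_four hGd hbd i (iF1 i)
      (((iT i).const_mul 4).congr (ae_of_all _ fun x => by simp only; ring)) (iF2 i)
    simp only [he', hρ'] at h
    rw [← h, ← integral_const_mul]
    exact integral_congr_ae (ae_of_all _ fun x => by simp only; ring)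
  have ibp2 : ∀ i, ∫ x, ρ x ^ 2 * G x ^ 3 * fderiv ℝ (fun y => fderiv ℝ G y (e i)) x (e i) =
      -∫ x, (fderiv ℝ (fun y => ρ y ^ 2) x (e i) * G x ^ 3 + ρ x ^ 2 * (3 * G x ^ 2 * fderiv ℝ G x (e i))) *
        fderiv ℝ G x (e i) := by
    intro i
    have h := integral_rhoSq_mul_cube_mul_fderiv_fderiv hG i (iF3 i) (iL i) (iF4 i)
    simp only [he', hρ'] at h
    exact h
  have ibp3 : ∀ j : Fin 3, j = 0 ∨ j = 1 →
      4 * ∫ x, ρ x * x j * G x ^ 3 * fderiv ℝ G x (e j) = -∫ x, (2 * x j ^ 2 + ρ x) * G x ^ 4 := by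
    intro j hj
    have h := integral_rho_mul_coord_mul_fderiv_pow_four hGd hj
      ((key cP bP (ixGG j hj)).congr (ae_of_all _ fun x => by simp only; ring))
      (((iX j hj).const_mul 4).congr (ae_of_all _ fun x => by simp only; ring))
      ((((ixxG4 j hj).const_mul 2).add iP4).congr (ae_of_all _ fun x => by simp only [Pi.add_apply]; ring))
    simp only [he', hρ'] at h
    rw [← h, ← integral_const_mul]
    exact integral_congr_ae (ae_of_all _ fun x => by simp only; ring)
  -- names for the integrals
  set T : Fin 3 → ℝ := fun i => ∫ x, ρ x ^ 2 * b x i * (G x ^ 3 * fderiv ℝ G x (e i)) with hT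
  set L : Fin 3 → ℝ := fun i => ∫ x, ρ x ^ 2 * G x ^ 3 * fderiv ℝ (fun y => fderiv ℝ G y (e i)) x (e i)
    with hL
  set X : ℝ := ∫ x, ρ x * G x ^ 3 * (x 0 * fderiv ℝ G x (e 0) + x 1 * fderiv ℝ G x (e 1)) with hX
  set Dt : ℝ := ∫ x, ρ x ^ 2 * G x ^ 2 * (fderiv ℝ G x (e 0) ^ 2 + fderiv ℝ G x (e 1) ^ 2 +
    fderiv ℝ G x (e 2) ^ 2) with hDt
  set Wt : ℝ := ∫ x, ρ x ^ 2 * W x * G x ^ 4 with hWt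
  set P4 : ℝ := ∫ x, ρ x * G x ^ 4 with hP4
  -- transport: `4 Σ Tᵢ = −4 Wt`
  have hTsum : 4 * (T 0 + T 1 + T 2) = -4 * Wt := by
    have hpt : ∀ x, (fderiv ℝ (fun y => ρ y ^ 2) x (e 0) * b x 0 + ρ x ^ 2 * fderiv ℝ b x (e 0) 0) * G x ^ 4 +
        (fderiv ℝ (fun y => ρ y ^ 2) x (e 1) * b x 1 + ρ x ^ 2 * fderiv ℝ b x (e 1) 1) * G x ^ 4 +
        (fderiv ℝ (fun y => ρ y ^ 2) x (e 2) * b x 2 + ρ x ^ 2 * fderiv ℝ b x (e 2) 2) * G x ^ 4 =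
        4 * (ρ x ^ 2 * W x * G x ^ 4) := by
      intro x
      rw [hσ0, hσ1, hσ2]
      have h1 := hW x
      have h2 := hdivx x
      have h3 : ρ x ^ 2 * (fderiv ℝ b x (e 0) 0 + fderiv ℝ b x (e 1) 1 + fderiv ℝ b x (e 2) 2) * G x ^ 4 = 0 := by
        rw [h2]; ring
      linear_combination (4 * ρ x * G x ^ 4) * h1 + h3
    have hsum := integral_congr_ae (μ := volume) (ae_of_all _ hpt)
    rw [integral_add_three (iF2 0) (iF2 1) (iF2 2), integral_const_mul] at hsum
    have e0 := ibp1 0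
    have e1 := ibp1 1
    have e2 := ibp1 2
    simp only [hT, hWt]
    linarith
  -- diffusion: `Σ Lᵢ = −4X − 3 Dt`
  have hLsum : L 0 + L 1 + L 2 = -4 * X - 3 * Dt := by
    have hpt : ∀ x, (fderiv ℝ (fun y => ρ y ^ 2) x (e 0) * G x ^ 3 + ρ x ^ 2 * (3 * G x ^ 2 * fderiv ℝ G x (e 0))) *
          fderiv ℝ G x (e 0) +
        (fderiv ℝ (fun y => ρ y ^ 2) x (e 1) * G x ^ 3 + ρ x ^ 2 * (3 * G x ^ 2 * fderiv ℝ G x (e 1))) *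
          fderiv ℝ G x (e 1) +
        (fderiv ℝ (fun y => ρ y ^ 2) x (e 2) * G x ^ 3 + ρ x ^ 2 * (3 * G x ^ 2 * fderiv ℝ G x (e 2))) *
          fderiv ℝ G x (e 2) =
        4 * (ρ x * G x ^ 3 * (x 0 * fderiv ℝ G x (e 0) + x 1 * fderiv ℝ G x (e 1))) +
          3 * (ρ x ^ 2 * G x ^ 2 * (fderiv ℝ G x (e 0) ^ 2 + fderiv ℝ G x (e 1) ^ 2 +
            fderiv ℝ G x (e 2) ^ 2)) := by
      intro x
      rw [hσ0, hσ1, hσ2]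
      ring
    have hsum := integral_congr_ae (μ := volume) (ae_of_all _ hpt)
    rw [integral_add_three (iF4 0) (iF4 1) (iF4 2), integral_add (iXf.const_mul 4) (iDf.const_mul 3),
      integral_const_mul, integral_const_mul] at hsum
    have e0 := ibp2 0
    have e1 := ibp2 1
    have e2 := ibp2 2
    simp only [hL, hX, hDt]
    linarith
  -- the axis/drift term: `X = −P4`
  have hXP : X = -P4 := by
    have e0 := ibp3 0 (Or.inl rfl)
    have e1 := ibp3 1 (Or.inr rfl)
    have hs : (∫ x, (2 * x 0 ^ 2 + ρ x) * G x ^ 4) + ∫ x, (2 * x 1 ^ 2 + ρ x) * G x ^ 4 = 4 * P4 := by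
      rw [← integral_add ((((ixxG4 0 (Or.inl rfl)).const_mul 2).add iP4).congr
          (ae_of_all _ fun x => by simp only [Pi.add_apply]; ring))
        ((((ixxG4 1 (Or.inr rfl)).const_mul 2).add iP4).congr
          (ae_of_all _ fun x => by simp only [Pi.add_apply]; ring)),
        hP4, ← integral_const_mul]
      exact integral_congr_ae (ae_of_all _ fun x => by simp only [hρ]; ring)
    have hx : 4 * X = 4 * (∫ x, ρ x * x 0 * G x ^ 3 * fderiv ℝ G x (e 0)) +
        4 * ∫ x, ρ x * x 1 * G x ^ 3 * fderiv ℝ G x (e 1) := by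
      rw [hX, ← mul_add, ← integral_add (iX 0 (Or.inl rfl)) (iX 1 (Or.inr rfl))]
      congr 1
      exact integral_congr_ae (ae_of_all _ fun x => by simp only; ring)
    linarith
  -- integrate the pointwise equation against `σ G³`
  have hmain : (∫ x, ρ x ^ 2 * G x ^ 3 * G' x) =
      ν * (L 0 + L 1 + L 2) + 2 * ν * X - 2 * Wt - (T 0 + T 1 + T 2) := by
    have hpt : ∀ x, ρ x ^ 2 * G x ^ 3 * G' x =
        ν * (ρ x ^ 2 * G x ^ 3 * fderiv ℝ (fun y => fderiv ℝ G y (e 0)) x (e 0) +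
            ρ x ^ 2 * G x ^ 3 * fderiv ℝ (fun y => fderiv ℝ G y (e 1)) x (e 1) +
            ρ x ^ 2 * G x ^ 3 * fderiv ℝ (fun y => fderiv ℝ G y (e 2)) x (e 2)) +
          2 * ν * (ρ x * G x ^ 3 * (x 0 * fderiv ℝ G x (e 0) + x 1 * fderiv ℝ G x (e 1))) -
          2 * (ρ x ^ 2 * W x * G x ^ 4) -
          (ρ x ^ 2 * b x 0 * (G x ^ 3 * fderiv ℝ G x (e 0)) + ρ x ^ 2 * b x 1 * (G x ^ 3 * fderiv ℝ G x (e 1)) +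
            ρ x ^ 2 * b x 2 * (G x ^ 3 * fderiv ℝ G x (e 2))) := by
      intro x
      have h := heq x
      rw [hDGb x, hlap x] at h
      have hq := hρq x
      have hσG3q : ρ x ^ 2 * G x ^ 3 * (2 * radDerivQuot G x) =
          2 * (ρ x * G x ^ 3 * (x 0 * fderiv ℝ G x (e 0) + x 1 * fderiv ℝ G x (e 1))) := by
        rw [← hq]; ring
      linear_combination (ρ x ^ 2 * G x ^ 3) * h + ν * hσG3q
    have iLs : Integrable (fun x => ν * (ρ x ^ 2 * G x ^ 3 * fderiv ℝ (fun y => fderiv ℝ G y (e 0)) x (e 0) +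
        ρ x ^ 2 * G x ^ 3 * fderiv ℝ (fun y => fderiv ℝ G y (e 1)) x (e 1) +
        ρ x ^ 2 * G x ^ 3 * fderiv ℝ (fun y => fderiv ℝ G y (e 2)) x (e 2))) volume :=
      (integrable_add_three (iL 0) (iL 1) (iL 2)).const_mul ν
    have iTs : Integrable (fun x => ρ x ^ 2 * b x 0 * (G x ^ 3 * fderiv ℝ G x (e 0)) +
        ρ x ^ 2 * b x 1 * (G x ^ 3 * fderiv ℝ G x (e 1)) + ρ x ^ 2 * b x 2 * (G x ^ 3 * fderiv ℝ G x (e 2))) volume :=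
      integrable_add_three (iT 0) (iT 1) (iT 2)
    have hsum := integral_congr_ae (μ := volume) (ae_of_all _ hpt)
    rw [integral_add_sub_sub iLs (iXf.const_mul _) (iW.const_mul 2) iTs, integral_const_mul,
      integral_const_mul, integral_const_mul, integral_add_three (iL 0) (iL 1) (iL 2),
      integral_add_three (iT 0) (iT 1) (iT 2)] at hsum
    simp only [hT, hL, hX, hWt]
    linarith
  -- conclude
  have hfinal : (∫ x, ρ x ^ 2 * G x ^ 3 * G' x) = 2 * ν * P4 - 3 * ν * Dt - Wt := by
    have hT' : T 0 + T 1 + T 2 = -Wt := by linarith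
    rw [hmain, hLsum, hT', hXP]
    ring
  rw [hfinal, hDt, hP4]

end Identity

/-! ### The Hardy-type bound `∫ ρG⁴ ≤ ∫ σG²|∇G|²` -/

section Hardy

variable {G : EuclideanSpace ℝ (Fin 3) → ℝ}

set_option maxHeartbeats 800000 in
/-- **`∫ ρ G⁴ ≤ ∫ σ G² |∇G|²`** (`ρ = x₀² + x₁²`, `σ = ρ²`) for `G ∈ C¹` with `G, ∂ᵢG, xⱼG, xⱼ∂ᵢG ∈ L²`
(`j = 0, 1`) and `ρG²` bounded: the smooth, weighted form of
`3∫(v^θ)²|∇v^θ|² + ∫(v^θ)⁴/r² ≥ ∫(v^θ)⁴/r²` in the variable `v^θ = rΦ`. Proof: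
`0 ≤ ∫ G²(|G x_h + ρ∇G|²) = ∫ρG⁴ + 2∫ρG³DG[x_h] + ∫σG²|∇G|²` and `∫ρG³DG[x_h] = −∫ρG⁴` (by parts).
[cite: LeiZhang2017, §3 p. 9] -/
theorem integral_rho_mul_pow_four_le (hG : ContDiff ℝ 1 G) (h0 : MemLp G 2 volume)
    (h1 : ∀ i : Fin 3, MemLp (fun x => fderiv ℝ G x (EuclideanSpace.single i 1)) 2 volume)
    (hxG : ∀ j : Fin 3, j = 0 ∨ j = 1 → MemLp (fun x : EuclideanSpace ℝ (Fin 3) => x j * G x) 2 volume)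
    (hxD : ∀ j : Fin 3, j = 0 ∨ j = 1 → ∀ i : Fin 3,
      MemLp (fun x : EuclideanSpace ℝ (Fin 3) => x j * fderiv ℝ G x (EuclideanSpace.single i 1)) 2 volume)
    {B₂ : ℝ} (hB₂ : ∀ x, (x 0 ^ 2 + x 1 ^ 2) * G x ^ 2 ≤ B₂) :
    ∫ x, (x 0 ^ 2 + x 1 ^ 2) * G x ^ 4 ≤
      ∫ x, (x 0 ^ 2 + x 1 ^ 2) ^ 2 * G x ^ 2 *
          (fderiv ℝ G x (EuclideanSpace.single 0 1) ^ 2 + fderiv ℝ G x (EuclideanSpace.single 1 1) ^ 2 +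
            fderiv ℝ G x (EuclideanSpace.single 2 1) ^ 2) := by
  set e : Fin 3 → EuclideanSpace ℝ (Fin 3) := fun i => EuclideanSpace.single i 1 with he
  have he' : ∀ i, EuclideanSpace.single i (1 : ℝ) = e i := fun i => rfl
  simp only [he'] at h1 hxD ⊢
  set ρ : EuclideanSpace ℝ (Fin 3) → ℝ := fun y => y 0 ^ 2 + y 1 ^ 2 with hρ
  have hρ' : ∀ x : EuclideanSpace ℝ (Fin 3), x 0 ^ 2 + x 1 ^ 2 = ρ x := fun x => rfl
  simp only [hρ'] at hB₂ ⊢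
  have hGd : Differentiable ℝ G := hG.differentiable one_ne_zero
  have cG : Continuous G := hG.continuous
  have cρ : Continuous ρ := (contDiff_horizSq (n := 0)).continuous
  have cx : ∀ i : Fin 3, Continuous fun x : EuclideanSpace ℝ (Fin 3) => x i := fun i =>
    (contDiff_piLp_apply (𝕜 := ℝ) (p := 2) (n := 0) (i := i)).continuous
  have cxG : ∀ i : Fin 3, Continuous fun x : EuclideanSpace ℝ (Fin 3) => x i * G x := fun i => (cx i).mul cG
  have cP : Continuous fun x => ρ x * G x ^ 2 := cρ.mul (cG.pow 2)
  have hPx : ∀ x, ρ x * G x ^ 2 = (x 0 * G x) ^ 2 + (x 1 * G x) ^ 2 := fun x => by simp only [hρ]; ring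
  have bP : ∀ x, ‖ρ x * G x ^ 2‖ ≤ B₂ := fun x => by
    rw [Real.norm_of_nonneg (by positivity)]; exact hB₂ x
  have bxG2 : ∀ i : Fin 3, i = 0 ∨ i = 1 → ∀ x, ‖(x i * G x) ^ 2‖ ≤ B₂ := by
    intro i hi x
    rw [Real.norm_of_nonneg (sq_nonneg _)]
    have hx : x i ^ 2 ≤ ρ x := by
      rcases hi with rfl | rfl
      · show x 0 ^ 2 ≤ x 0 ^ 2 + x 1 ^ 2; nlinarith [sq_nonneg (x 1)]
      · show x 1 ^ 2 ≤ x 0 ^ 2 + x 1 ^ 2; nlinarith [sq_nonneg (x 0)]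
    calc (x i * G x) ^ 2 = x i ^ 2 * G x ^ 2 := by ring
      _ ≤ ρ x * G x ^ 2 := mul_le_mul_of_nonneg_right hx (sq_nonneg _)
      _ ≤ B₂ := hB₂ x
  have key : ∀ {f g : EuclideanSpace ℝ (Fin 3) → ℝ} {C : ℝ}, Continuous f → (∀ x, ‖f x‖ ≤ C) →
      Integrable g volume → Integrable (fun x => f x * g x) volume :=
    fun hf hC hg => hg.bdd_mul hf.aestronglyMeasurable (ae_of_all _ hC)
  -- integrability
  have iGG : Integrable (fun x => G x * G x) volume := h0.integrable_mul h0
  have iP4 : Integrable (fun x => ρ x * G x ^ 4) volume :=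
    (key cP bP iGG).congr (ae_of_all _ fun x => by simp only; ring)
  have ixGD : ∀ j : Fin 3, j = 0 ∨ j = 1 → ∀ i, Integrable (fun x => x j * G x * fderiv ℝ G x (e i)) volume :=
    fun j hj i => (hxG j hj).integrable_mul (h1 i)
  have ixGG : ∀ j : Fin 3, j = 0 ∨ j = 1 → Integrable (fun x => x j * G x * G x) volume :=
    fun j hj => (hxG j hj).integrable_mul h0
  have iX : ∀ i : Fin 3, i = 0 ∨ i = 1 →
      Integrable (fun x => ρ x * x i * G x ^ 3 * fderiv ℝ G x (e i)) volume := by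
    intro i hi
    exact (key cP bP (ixGD i hi i)).congr (ae_of_all _ fun x => by simp only; ring)
  have iXDD : ∀ i, Integrable (fun x => (x 0 * fderiv ℝ G x (e i)) ^ 2 + (x 1 * fderiv ℝ G x (e i)) ^ 2) volume :=
    fun i => ((hxD 0 (Or.inl rfl) i).integrable_sq).add ((hxD 1 (Or.inr rfl) i).integrable_sq)
  have iD : ∀ i, Integrable (fun x => ρ x ^ 2 * G x ^ 2 * fderiv ℝ G x (e i) ^ 2) volume := fun i =>
    (key cP bP (iXDD i)).congr (ae_of_all _ fun x => by simp only [hρ]; ring)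
  have ixxG4 : ∀ i : Fin 3, i = 0 ∨ i = 1 → Integrable (fun x => x i ^ 2 * G x ^ 4) volume := by
    intro i hi
    have cx2 : Continuous fun x : EuclideanSpace ℝ (Fin 3) => (x i * G x) ^ 2 := (cxG i).pow 2
    exact (key cx2 (bxG2 i hi) iGG).congr (ae_of_all _ fun x => by simp only; ring)
  have iXf : Integrable (fun x => ρ x * G x ^ 3 * (x 0 * fderiv ℝ G x (e 0) + x 1 * fderiv ℝ G x (e 1))) volume :=
    ((iX 0 (Or.inl rfl)).add (iX 1 (Or.inr rfl))).congr (ae_of_all _ fun x => by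
      simp only [Pi.add_apply]; ring)
  have iDf : Integrable (fun x => ρ x ^ 2 * G x ^ 2 * (fderiv ℝ G x (e 0) ^ 2 + fderiv ℝ G x (e 1) ^ 2 +
      fderiv ℝ G x (e 2) ^ 2)) volume :=
    (((iD 0).add (iD 1)).add (iD 2)).congr (ae_of_all _ fun x => by
      simp only [Pi.add_apply]; ring)
  -- by parts: `∫ ρ xⱼ 4G³∂ⱼG = −∫ (2xⱼ² + ρ) G⁴`
  have ibp3 : ∀ j : Fin 3, j = 0 ∨ j = 1 →
      4 * ∫ x, ρ x * x j * G x ^ 3 * fderiv ℝ G x (e j) = -∫ x, (2 * x j ^ 2 + ρ x) * G x ^ 4 := by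
    intro j hj
    have h := integral_rho_mul_coord_mul_fderiv_pow_four hGd hj
      ((key cP bP (ixGG j hj)).congr (ae_of_all _ fun x => by simp only; ring))
      (((iX j hj).const_mul 4).congr (ae_of_all _ fun x => by simp only; ring))
      ((((ixxG4 j hj).const_mul 2).add iP4).congr (ae_of_all _ fun x => by simp only [Pi.add_apply]; ring))
    simp only [he', hρ'] at h
    rw [← h, ← integral_const_mul]
    exact integral_congr_ae (ae_of_all _ fun x => by simp only; ring)
  set X : ℝ := ∫ x, ρ x * G x ^ 3 * (x 0 * fderiv ℝ G x (e 0) + x 1 * fderiv ℝ G x (e 1)) with hX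
  set Dt : ℝ := ∫ x, ρ x ^ 2 * G x ^ 2 * (fderiv ℝ G x (e 0) ^ 2 + fderiv ℝ G x (e 1) ^ 2 +
    fderiv ℝ G x (e 2) ^ 2) with hDt
  set P4 : ℝ := ∫ x, ρ x * G x ^ 4 with hP4
  have hXP : X = -P4 := by
    have e0 := ibp3 0 (Or.inl rfl)
    have e1 := ibp3 1 (Or.inr rfl)
    have hs : (∫ x, (2 * x 0 ^ 2 + ρ x) * G x ^ 4) + ∫ x, (2 * x 1 ^ 2 + ρ x) * G x ^ 4 = 4 * P4 := by
      rw [← integral_add ((((ixxG4 0 (Or.inl rfl)).const_mul 2).add iP4).congr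
          (ae_of_all _ fun x => by simp only [Pi.add_apply]; ring))
        ((((ixxG4 1 (Or.inr rfl)).const_mul 2).add iP4).congr
          (ae_of_all _ fun x => by simp only [Pi.add_apply]; ring)),
        hP4, ← integral_const_mul]
      exact integral_congr_ae (ae_of_all _ fun x => by simp only [hρ]; ring)
    have hx : 4 * X = 4 * (∫ x, ρ x * x 0 * G x ^ 3 * fderiv ℝ G x (e 0)) +
        4 * ∫ x, ρ x * x 1 * G x ^ 3 * fderiv ℝ G x (e 1) := by
      rw [hX, ← mul_add, ← integral_add (iX 0 (Or.inl rfl)) (iX 1 (Or.inr rfl))]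
      congr 1
      exact integral_congr_ae (ae_of_all _ fun x => by simp only; ring)
    linarith
  -- the nonnegative density `Q = G² |G x_h + ρ ∇G|²`
  have hQ : 0 ≤ ∫ x, (ρ x * G x ^ 4 + 2 * (ρ x * G x ^ 3 * (x 0 * fderiv ℝ G x (e 0) + x 1 * fderiv ℝ G x (e 1))) +
      ρ x ^ 2 * G x ^ 2 * (fderiv ℝ G x (e 0) ^ 2 + fderiv ℝ G x (e 1) ^ 2 + fderiv ℝ G x (e 2) ^ 2)) := by
    refine integral_nonneg fun x => ?_
    have hq : ρ x * G x ^ 4 + 2 * (ρ x * G x ^ 3 * (x 0 * fderiv ℝ G x (e 0) + x 1 * fderiv ℝ G x (e 1))) +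
        ρ x ^ 2 * G x ^ 2 * (fderiv ℝ G x (e 0) ^ 2 + fderiv ℝ G x (e 1) ^ 2 + fderiv ℝ G x (e 2) ^ 2) =
        G x ^ 2 * ((x 0 * G x + ρ x * fderiv ℝ G x (e 0)) ^ 2 + (x 1 * G x + ρ x * fderiv ℝ G x (e 1)) ^ 2 +
          (ρ x * fderiv ℝ G x (e 2)) ^ 2) := by
      simp only [hρ]; ring
    rw [hq]; positivity
  have i12 : Integrable (fun x => ρ x * G x ^ 4 +
      2 * (ρ x * G x ^ 3 * (x 0 * fderiv ℝ G x (e 0) + x 1 * fderiv ℝ G x (e 1)))) volume :=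
    iP4.add (iXf.const_mul 2)
  have hs : (∫ x, (ρ x * G x ^ 4 + 2 * (ρ x * G x ^ 3 * (x 0 * fderiv ℝ G x (e 0) + x 1 * fderiv ℝ G x (e 1))) +
      ρ x ^ 2 * G x ^ 2 * (fderiv ℝ G x (e 0) ^ 2 + fderiv ℝ G x (e 1) ^ 2 + fderiv ℝ G x (e 2) ^ 2))) =
      P4 + 2 * X + Dt := by
    rw [integral_add i12 iDf, integral_add iP4 (iXf.const_mul 2), integral_const_mul]
  rw [hs] at hQ
  change P4 ≤ Dt
  linarith

end Hardy

/-! ### The inequality `∫ σG³G' + ν∫ρG⁴ ≤ B_W ∫ σG⁴` and its application to `Φ = u^θ/r` -/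

section Estimate

variable {G G' W : EuclideanSpace ℝ (Fin 3) → ℝ} {b : EuclideanSpace ℝ (Fin 3) → EuclideanSpace ℝ (Fin 3)}
  {ν : ℝ}

/-- **`∫ σG³G' + ν ∫ ρG⁴ ≤ B_W ∫ σG⁴`** under the hypotheses of
`integral_rhoSq_mul_cube_mul_eq_of_phi_eq` and `ν ≥ 0` (the identity, the Hardy bound
`∫ρG⁴ ≤ ∫σG²|∇G|²`, and `|W| ≤ B_W`): the smooth form of
`d/dt‖v^θ‖⁴_{L⁴} + 4ν‖r⁻¹(v^θ)²‖²_{L²} ≤ 4‖vʳ/r‖_∞ ‖v^θ‖⁴_{L⁴}`. [cite: LeiZhang2017, §3 p. 9] -/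
theorem integral_rhoSq_mul_cube_mul_le (hG : ContDiff ℝ 2 G) (hax : IsAxisymmetricScalar G)
    (hb : ContDiff ℝ 1 b) (hdiv : VectorCalculus.IsDivFree b) (hWc : Continuous W) (hν : 0 ≤ ν)
    (h0 : MemLp G 2 volume)
    (h1 : ∀ i : Fin 3, MemLp (fun x => fderiv ℝ G x (EuclideanSpace.single i 1)) 2 volume)
    (hxG : ∀ j : Fin 3, j = 0 ∨ j = 1 → MemLp (fun x : EuclideanSpace ℝ (Fin 3) => x j * G x) 2 volume)
    (hxD : ∀ j : Fin 3, j = 0 ∨ j = 1 → ∀ i : Fin 3,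
      MemLp (fun x : EuclideanSpace ℝ (Fin 3) => x j * fderiv ℝ G x (EuclideanSpace.single i 1)) 2 volume)
    (hxG' : ∀ j : Fin 3, j = 0 ∨ j = 1 → MemLp (fun x : EuclideanSpace ℝ (Fin 3) => x j * G' x) 2 volume)
    (hΓDD : ∀ i : Fin 3, Integrable (fun x : EuclideanSpace ℝ (Fin 3) => (x 0 ^ 2 + x 1 ^ 2) * G x *
      fderiv ℝ (fun y => fderiv ℝ G y (EuclideanSpace.single i 1)) x (EuclideanSpace.single i 1)) volume)
    {BG : ℝ} (hGB : ∀ x, |G x| ≤ BG) {B₂ : ℝ} (hB₂ : ∀ x, (x 0 ^ 2 + x 1 ^ 2) * G x ^ 2 ≤ B₂)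
    {B : ℝ} (hbB : ∀ x, ‖b x‖ ≤ B) {B' : ℝ} (hDb : ∀ x, ‖fderiv ℝ b x‖ ≤ B')
    {BW : ℝ} (hWB : ∀ x, |W x| ≤ BW)
    (hW : ∀ x, x 0 * b x 0 + x 1 * b x 1 = (x 0 ^ 2 + x 1 ^ 2) * W x)
    (heq : ∀ x, G' x + fderiv ℝ G x (b x) = ν * ((Δ G) x + 2 * radDerivQuot G x) - 2 * W x * G x) :
    (∫ x, (x 0 ^ 2 + x 1 ^ 2) ^ 2 * G x ^ 3 * G' x) + ν * ∫ x, (x 0 ^ 2 + x 1 ^ 2) * G x ^ 4 ≤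
      BW * ∫ x, (x 0 ^ 2 + x 1 ^ 2) ^ 2 * G x ^ 4 := by
  have hid := integral_rhoSq_mul_cube_mul_eq_of_phi_eq hG hax hb hdiv hWc h0 h1 hxG hxD hxG' hΓDD hGB hB₂
    hbB hDb hWB hW heq
  have hhardy := integral_rho_mul_pow_four_le (hG.of_le (by norm_num)) h0 h1 hxG hxD hB₂
  -- `−∫ σWG⁴ ≤ B_W ∫ σG⁴`
  have cG : Continuous G := hG.continuous
  have cρ : Continuous fun y : EuclideanSpace ℝ (Fin 3) => y 0 ^ 2 + y 1 ^ 2 := (contDiff_horizSq (n := 0)).continuous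
  have cP : Continuous fun x : EuclideanSpace ℝ (Fin 3) => (x 0 ^ 2 + x 1 ^ 2) * G x ^ 2 := cρ.mul (cG.pow 2)
  have bP : ∀ x : EuclideanSpace ℝ (Fin 3), ‖(x 0 ^ 2 + x 1 ^ 2) * G x ^ 2‖ ≤ B₂ := fun x => by
    rw [Real.norm_of_nonneg (by positivity)]; exact hB₂ x
  have bW : ∀ x, ‖W x‖ ≤ BW := fun x => by rw [Real.norm_eq_abs]; exact hWB x
  have key : ∀ {f g : EuclideanSpace ℝ (Fin 3) → ℝ} {C : ℝ}, Continuous f → (∀ x, ‖f x‖ ≤ C) →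
      Integrable g volume → Integrable (fun x => f x * g x) volume :=
    fun hf hC hg => hg.bdd_mul hf.aestronglyMeasurable (ae_of_all _ hC)
  have hPx : ∀ x : EuclideanSpace ℝ (Fin 3), (x 0 ^ 2 + x 1 ^ 2) * G x ^ 2 = (x 0 * G x) ^ 2 + (x 1 * G x) ^ 2 :=
    fun x => by ring
  have iP : Integrable (fun x : EuclideanSpace ℝ (Fin 3) => (x 0 ^ 2 + x 1 ^ 2) * G x ^ 2) volume :=
    (((hxG 0 (Or.inl rfl)).integrable_sq).add ((hxG 1 (Or.inr rfl)).integrable_sq)).congr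
      (ae_of_all _ fun x => by simp only [Pi.add_apply, hPx])
  have iσG4 : Integrable (fun x : EuclideanSpace ℝ (Fin 3) => (x 0 ^ 2 + x 1 ^ 2) ^ 2 * G x ^ 4) volume :=
    (key cP bP iP).congr (ae_of_all _ fun x => by simp only; ring)
  have iW : Integrable (fun x : EuclideanSpace ℝ (Fin 3) => (x 0 ^ 2 + x 1 ^ 2) ^ 2 * W x * G x ^ 4) volume :=
    (key hWc bW (key cP bP iP)).congr (ae_of_all _ fun x => by simp only; ring)
  have hWt : -(∫ x, (x 0 ^ 2 + x 1 ^ 2) ^ 2 * W x * G x ^ 4) ≤ BW * ∫ x, (x 0 ^ 2 + x 1 ^ 2) ^ 2 * G x ^ 4 := by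
    rw [← integral_neg, ← integral_const_mul]
    refine integral_mono iW.neg (iσG4.const_mul BW) fun x => ?_
    have hσ : 0 ≤ (x 0 ^ 2 + x 1 ^ 2) ^ 2 * G x ^ 4 := by positivity
    have hw := hWB x
    have : -W x ≤ BW := by linarith [neg_abs_le (W x)]
    show -((x 0 ^ 2 + x 1 ^ 2) ^ 2 * W x * G x ^ 4) ≤ BW * ((x 0 ^ 2 + x 1 ^ 2) ^ 2 * G x ^ 4)
    nlinarith
  rw [hid]
  nlinarith [mul_le_mul_of_nonneg_left hhardy hν]

variable {S : Set ℝ} {v : ℝ → EuclideanSpace ℝ (Fin 3) → EuclideanSpace ℝ (Fin 3)}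
  {q : ℝ → EuclideanSpace ℝ (Fin 3) → ℝ}

set_option maxHeartbeats 800000 in
/-- **The `L⁴` estimate of `v^θ` at a fixed time** (Lei–Zhang 2017, §3 p. 9; the end of the
proof of Wei 2016, Thm. 1.1), in the smooth variable `Φ = angVelQuot (v t)`
(`(v^θ)⁴ = σΦ⁴`, `(v^θ)⁴/r² = ρΦ⁴`, `Φ' = angVelQuot (∂ₜv t)`): for a classical solution of the
unforced system with viscosity `ν ≥ 0` on a time set `S ⊆ closure (interior S)` of unique
differentiability with axisymmetric velocity, at `t ∈ S`, if `Φ, ∂ᵢΦ ∈ L²`,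
`v t, ∂ₜv t ∈ L²`, `‖Dv(t)‖ ∈ L²`, `D(∂ᵢv(t)) ∈ L²`, `v t`, `Dv(t)` bounded and `|vʳ/r| ≤ B_W`,
then `∫ σΦ³Φ' + ν ∫ ρΦ⁴ ≤ B_W ∫ σΦ⁴`, i.e.
`d/dt ∫(v^θ)⁴ + 4ν ∫(v^θ)⁴/r² ≤ 4‖vʳ/r‖_∞ ∫(v^θ)⁴`. [cite: LeiZhang2017, §3 p. 9] -/
theorem _root_.Literature.Analysis.FluidPDE.IsClassicalNSSolutionOn.integral_rhoSq_mul_angVelQuot_cube_le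
    (hcl : IsClassicalNSSolutionOn S ν 0 v q) (hν : 0 ≤ ν) (hS : UniqueDiffOn ℝ S)
    (hax : ∀ s ∈ S, IsAxisymmetric (v s)) {t : ℝ} (ht : t ∈ S)
    (h0 : MemLp (angVelQuot (v t)) 2 volume)
    (h1 : ∀ i : Fin 3, MemLp (fun x => fderiv ℝ (angVelQuot (v t)) x (EuclideanSpace.single i 1)) 2 volume)
    (hv0 : MemLp (v t) 2 volume) (hvt : MemLp (timeDerivWithin S v t) 2 volume)
    (hv1 : MemLp (fun x => fderiv ℝ (v t) x) 2 volume)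
    (hv2 : ∀ i : Fin 3, MemLp (fun x => fderiv ℝ (fun y => fderiv ℝ (v t) y (EuclideanSpace.single i 1)) x) 2 volume)
    {B : ℝ} (hbB : ∀ x, ‖v t x‖ ≤ B) {B' : ℝ} (hDb : ∀ x, ‖fderiv ℝ (v t) x‖ ≤ B')
    {BW : ℝ} (hWB : ∀ x, |radVelQuot (v t) x| ≤ BW) :
    (∫ x, (x 0 ^ 2 + x 1 ^ 2) ^ 2 * angVelQuot (v t) x ^ 3 * angVelQuot (timeDerivWithin S v t) x) +
        ν * ∫ x, (x 0 ^ 2 + x 1 ^ 2) * angVelQuot (v t) x ^ 4 ≤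
      BW * ∫ x, (x 0 ^ 2 + x 1 ^ 2) ^ 2 * angVelQuot (v t) x ^ 4 := by
  have hv : ContDiff ℝ ∞ (v t) := hcl.contDiff_velocity ht
  have hv1' : ContDiff ℝ 1 (v t) := hv.of_le (by norm_cast)
  have hv2' : ContDiff ℝ 2 (v t) := hv.of_le (by norm_cast)
  have hv3 : ContDiff ℝ 3 (v t) := hv.of_le (by norm_cast)
  have hv4 : ContDiff ℝ 4 (v t) := hv.of_le (by norm_cast)
  have haxt : IsAxisymmetric (v t) := hax t ht
  have hsm : IsSmoothSpaceTimeOn S v := hcl.smooth_velocity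
  have hw : ContDiff ℝ ∞ (timeDerivWithin S v t) := hsm.contDiff_timeDerivWithin_slice hS ht
  have hw2 : ContDiff ℝ 2 (timeDerivWithin S v t) := hw.of_le (by norm_cast)
  have hwax : IsAxisymmetric (timeDerivWithin S v t) := hsm.isAxisymmetric_timeDerivWithin hax ht
  have hΦ2 : ContDiff ℝ 2 (angVelQuot (v t)) := contDiff_angVelQuot (n := 2) hv4
  have hΦax : IsAxisymmetricScalar (angVelQuot (v t)) := haxt.isAxisymmetricScalar_angVelQuot hv2'
  have hW2 : ContDiff ℝ 2 (radVelQuot (v t)) := contDiff_radVelQuot (n := 2) hv4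
  have hn : ∀ i : Fin 3, ‖(EuclideanSpace.single i (1 : ℝ) : EuclideanSpace ℝ (Fin 3))‖ ≤ 1 := fun i => by simp
  -- the weighted `L²` hypotheses from the pointwise bounds
  have cx : ∀ i : Fin 3, Continuous fun x : EuclideanSpace ℝ (Fin 3) => x i := fun i =>
    (contDiff_piLp_apply (𝕜 := ℝ) (p := 2) (n := 0) (i := i)).continuous
  have hxG : ∀ j : Fin 3, j = 0 ∨ j = 1 → MemLp (fun x : EuclideanSpace ℝ (Fin 3) => x j * angVelQuot (v t) x) 2 volume := by
    intro j hj
    refine hv0.of_le ((cx j).mul hΦ2.continuous).aestronglyMeasurable (ae_of_all _ fun x => ?_)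
    rw [Real.norm_eq_abs]; exact haxt.abs_coord_mul_angVelQuot_le hv2' hj x
  have hxG' : ∀ j : Fin 3, j = 0 ∨ j = 1 →
      MemLp (fun x : EuclideanSpace ℝ (Fin 3) => x j * angVelQuot (timeDerivWithin S v t) x) 2 volume := by
    intro j hj
    have hΦ'c : Continuous (angVelQuot (timeDerivWithin S v t)) :=
      (contDiff_angVelQuot (n := 0) (by exact_mod_cast hw2)).continuous
    refine hvt.of_le ((cx j).mul hΦ'c).aestronglyMeasurable (ae_of_all _ fun x => ?_)
    rw [Real.norm_eq_abs]; exact hwax.abs_coord_mul_angVelQuot_le hw2 hj x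
  have hv1n : MemLp (fun x => 4 * ‖fderiv ℝ (v t) x‖) 2 volume := (hv1.norm.const_mul 4)
  have hxD : ∀ j : Fin 3, j = 0 ∨ j = 1 → ∀ i : Fin 3,
      MemLp (fun x : EuclideanSpace ℝ (Fin 3) => x j * fderiv ℝ (angVelQuot (v t)) x (EuclideanSpace.single i 1)) 2 volume := by
    intro j hj i
    have hc : Continuous fun x : EuclideanSpace ℝ (Fin 3) => x j * fderiv ℝ (angVelQuot (v t)) x (EuclideanSpace.single i 1) :=
      (cx j).mul ((hΦ2.continuous_fderiv two_ne_zero).clm_apply continuous_const)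
    refine hv1n.of_le hc.aestronglyMeasurable (ae_of_all _ fun x => ?_)
    rw [Real.norm_eq_abs, Real.norm_of_nonneg (by positivity)]
    exact haxt.abs_coord_mul_fderiv_angVelQuot_le hv3 hj (hn i) x
  have hΓDD : ∀ i : Fin 3, Integrable (fun x : EuclideanSpace ℝ (Fin 3) => (x 0 ^ 2 + x 1 ^ 2) * angVelQuot (v t) x *
      fderiv ℝ (fun y => fderiv ℝ (angVelQuot (v t)) y (EuclideanSpace.single i 1)) x (EuclideanSpace.single i 1)) volume := by
    intro i
    -- the majorant `20 ‖Dv‖² + ‖v‖ ‖D(∂ᵢv)‖`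
    have imaj : Integrable (fun x => 20 * ‖fderiv ℝ (v t) x‖ ^ 2 +
        ‖v t x‖ * ‖fderiv ℝ (fun y => fderiv ℝ (v t) y (EuclideanSpace.single i 1)) x‖) volume := by
      have h1' : Integrable (fun x => ‖fderiv ℝ (v t) x‖ ^ 2) volume := by
        have := hv1.norm.integrable_sq
        exact this
      have h2' : Integrable (fun x => ‖v t x‖ * ‖fderiv ℝ (fun y => fderiv ℝ (v t) y (EuclideanSpace.single i 1)) x‖)
          volume := hv0.norm.integrable_mul (hv2 i).norm
      exact (h1'.const_mul 20).add h2'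
    have hc : Continuous fun x : EuclideanSpace ℝ (Fin 3) => (x 0 ^ 2 + x 1 ^ 2) * angVelQuot (v t) x *
        fderiv ℝ (fun y => fderiv ℝ (angVelQuot (v t)) y (EuclideanSpace.single i 1)) x (EuclideanSpace.single i 1) := by
      have hD2 : ContDiff ℝ 0 fun y => fderiv ℝ (angVelQuot (v t)) y (EuclideanSpace.single i 1) :=
        (contDiff_fderiv_apply_const_succ (n := 1) (by exact_mod_cast hΦ2) _).of_le (by norm_num)
      have hD2c : Continuous fun x => fderiv ℝ (fun y => fderiv ℝ (angVelQuot (v t)) y (EuclideanSpace.single i 1)) x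
          (EuclideanSpace.single i 1) :=
        ((contDiff_fderiv_apply_const_succ (n := 1) (by exact_mod_cast hΦ2) _).continuous_fderiv
          one_ne_zero).clm_apply continuous_const
      exact ((contDiff_horizSq (n := 0)).continuous.mul hΦ2.continuous).mul hD2c
    refine imaj.mono' hc.aestronglyMeasurable (ae_of_all _ fun x => ?_)
    have hΓ : (x 0 ^ 2 + x 1 ^ 2) * angVelQuot (v t) x = swirl (v t) x := by
      rw [← cylRadius_sq]; exact haxt.cylRadius_sq_mul_angVelQuot hv2' x
    rw [Real.norm_eq_abs, hΓ]
    exact haxt.abs_swirl_mul_fderiv_fderiv_angVelQuot_le hv4 (hn i) x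
  have hB₂ : ∀ x : EuclideanSpace ℝ (Fin 3), (x 0 ^ 2 + x 1 ^ 2) * angVelQuot (v t) x ^ 2 ≤ B ^ 2 :=
    fun x => (haxt.horizSq_mul_angVelQuot_sq_le hv2' x).trans (pow_le_pow_left₀ (norm_nonneg _) (hbB x) 2)
  have hGB : ∀ x, |angVelQuot (v t) x| ≤ B' := fun x => (haxt.abs_angVelQuot_le_norm_fderiv hv2' x).trans (hDb x)
  have hWrel : ∀ x : EuclideanSpace ℝ (Fin 3), x 0 * v t x 0 + x 1 * v t x 1 =
      (x 0 ^ 2 + x 1 ^ 2) * radVelQuot (v t) x := fun x => by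
    rw [← cylRadius_sq, haxt.cylRadius_sq_mul_radVelQuot hv2' x]
  exact integral_rhoSq_mul_cube_mul_le hΦ2 hΦax hv1' (hcl.divFree t ht) hW2.continuous hν h0 h1 hxG hxD hxG'
    hΓDD hGB hB₂ hbB hDb hWB hWrel (fun x => hcl.angVelQuot_eq hS hax ht x)

end Estimate

end Wei2016

end Literature.Analysis.FluidPDE

end
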